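import Summits.AnomalousDissipation.AnomalousDissipation.Theorems.SawtoothPulseCascadeK1LocalisedCascadeKHModePairedSource

/-!
# K2 lane (route-2 `SawtoothPulseCascade`, crux dir `K1LocalisedCascade`): paired boundary terms of the single-mode source — the partner line and the common envelope

Sequel of `…KHModePairedSource` (ACL item stmt-AnomalousDissipation-19491; E6 / energy-form creation law). The same regrouping at the partner line
`y₀ = −¼` (`norm_src_negQuarter_lattice_le`: now the kernel's own line is `y = −¼`, so the weights of `1/(1+(u+s)²)` and `1/(1+(u−s)²)` are exchanged),
and the COMMON PAIRED ENVELOPE of both lines (`norm_src_lattice_env_le`):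
`‖src(±¼, s)‖ ≤ (1+q+2x²)(1+|s|/2)(1/(1+(u+s)²) + 1/(1+(u−s)²))/((1−q)κ²)` — quadratic Doppler decay in place of the linear one of
`…KHModeSource`, valid at every lattice mode `ξ = β + n`. No definitions; no statement about the crux. [cite: Drazin2002, §8.3 (8.36)–(8.38)] [problem: turb]
-/

-- `Summit.<Summit>.<Problem>`: single-conjunct summit, the duplicate namespace segment is deliberate.
set_option linter.dupNamespace false

noncomputable section

namespace Summit.AnomalousDissipation.AnomalousDissipation.Theorems.SawtoothPulseCascade.K2PhaseBudget

open Set MeasureTheory intervalIntegral Literature.Analysis.FluidPDE.SawtoothCascade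

/-! ## §1 Exponential identities for the line `y₀ = −¼` -/

section expidNeg

variable (a ξ s : ℝ)

/-- At `y = ¼` (kink of `T`, kernel smooth) the centre/crest `A`-terms agree. [folklore] -/
theorem expidN_14_A :
    Complex.exp ((((0 : ℝ) * s : ℝ)) * Complex.I) * Complex.exp ((((((2 * Real.pi * a) : ℝ)) : ℂ) + ((((2 * Real.pi * ξ) + (-(2 * Real.pi * a)) * s : ℝ)) : ℂ) * Complex.I) * ((((1 / 4 : ℝ)) : ℝ) : ℂ)) =
      Complex.exp ((((-(Real.pi * a)) * s : ℝ)) * Complex.I) * Complex.exp ((((((2 * Real.pi * a) : ℝ)) : ℂ) + ((((2 * Real.pi * ξ) + (2 * Real.pi * a) * s : ℝ)) : ℂ) * Complex.I) * ((((1 / 4 : ℝ)) : ℝ) : ℂ)) := by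
  rw [← Complex.exp_add, ← Complex.exp_add]
  congr 1
  push_cast
  ring

/-- At `y = ¼` the centre/crest `B`-terms agree. [folklore] -/
theorem expidN_14_B :
    Complex.exp ((((0 : ℝ) * s : ℝ)) * Complex.I) * Complex.exp ((((((-(2 * Real.pi * a)) : ℝ)) : ℂ) + ((((2 * Real.pi * ξ) + (-(2 * Real.pi * a)) * s : ℝ)) : ℂ) * Complex.I) * ((((1 / 4 : ℝ)) : ℝ) : ℂ)) =
      Complex.exp ((((-(Real.pi * a)) * s : ℝ)) * Complex.I) * Complex.exp ((((((-(2 * Real.pi * a)) : ℝ)) : ℂ) + ((((2 * Real.pi * ξ) + (2 * Real.pi * a) * s : ℝ)) : ℂ) * Complex.I) * ((((1 / 4 : ℝ)) : ℝ) : ℂ)) := by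
  rw [← Complex.exp_add, ← Complex.exp_add]
  congr 1
  push_cast
  ring

/-- `e^{iπas}·e^{κ/4}·e^{(κ+iΛ₊)(−¼)} = e^{−iΛ₋/4}`. [folklore] -/
theorem expidN_m14_W1 :
    Complex.exp ((((Real.pi * a) * s : ℝ)) * Complex.I) * Complex.exp (-(((2 * Real.pi * a) : ℝ) : ℂ) * (-(1 / 4 : ℝ))) * Complex.exp ((((((2 * Real.pi * a) : ℝ)) : ℂ) + ((((2 * Real.pi * ξ) + (2 * Real.pi * a) * s : ℝ)) : ℂ) * Complex.I) * (((-(1 / 4 : ℝ)) : ℝ) : ℂ)) = Complex.exp ((((-((2 * Real.pi * ξ) + (-(2 * Real.pi * a)) * s)) * (1 / 4) : ℝ) : ℂ) * Complex.I) := by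
  rw [← Complex.exp_add, ← Complex.exp_add]
  congr 1
  push_cast
  ring

/-- `e^{iπas}·e^{−κ/4}·e^{(−κ+iΛ₊)(−¼)} = e^{−iΛ₋/4}`. [folklore] -/
theorem expidN_m14_W2 :
    Complex.exp ((((Real.pi * a) * s : ℝ)) * Complex.I) * Complex.exp ((((2 * Real.pi * a) : ℝ) : ℂ) * (-(1 / 4 : ℝ))) * Complex.exp ((((((-(2 * Real.pi * a)) : ℝ)) : ℂ) + ((((2 * Real.pi * ξ) + (2 * Real.pi * a) * s : ℝ)) : ℂ) * Complex.I) * (((-(1 / 4 : ℝ)) : ℝ) : ℂ)) = Complex.exp ((((-((2 * Real.pi * ξ) + (-(2 * Real.pi * a)) * s)) * (1 / 4) : ℝ) : ℂ) * Complex.I) := by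
  rw [← Complex.exp_add, ← Complex.exp_add]
  congr 1
  push_cast
  ring

/-- `1·e^{−3κ/4}·e^{(κ+iΛ₋)(−¼)} = e^{−κ}·e^{−iΛ₋/4}`. [folklore] -/
theorem expidN_m14_W3 :
    Complex.exp ((((0 : ℝ) * s : ℝ)) * Complex.I) * Complex.exp (-(((2 * Real.pi * a) : ℝ) : ℂ) * (3 / 4 : ℝ)) * Complex.exp ((((((2 * Real.pi * a) : ℝ)) : ℂ) + ((((2 * Real.pi * ξ) + (-(2 * Real.pi * a)) * s : ℝ)) : ℂ) * Complex.I) * (((-(1 / 4 : ℝ)) : ℝ) : ℂ)) =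
      (Real.exp (-(2 * Real.pi * a)) : ℂ) * Complex.exp ((((-((2 * Real.pi * ξ) + (-(2 * Real.pi * a)) * s)) * (1 / 4) : ℝ) : ℂ) * Complex.I) := by
  rw [Complex.ofReal_exp, ← Complex.exp_add, ← Complex.exp_add, ← Complex.exp_add]
  congr 1
  push_cast
  ring

/-- `1·e^{3κ/4}·e^{(−κ+iΛ₋)(−¼)} = e^{κ}·e^{−iΛ₋/4}`. [folklore] -/
theorem expidN_m14_W4 :
    Complex.exp ((((0 : ℝ) * s : ℝ)) * Complex.I) * Complex.exp ((((2 * Real.pi * a) : ℝ) : ℂ) * (3 / 4 : ℝ)) * Complex.exp ((((((-(2 * Real.pi * a)) : ℝ)) : ℂ) + ((((2 * Real.pi * ξ) + (-(2 * Real.pi * a)) * s : ℝ)) : ℂ) * Complex.I) * (((-(1 / 4 : ℝ)) : ℝ) : ℂ)) =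
      (Real.exp (2 * Real.pi * a) : ℂ) * Complex.exp ((((-((2 * Real.pi * ξ) + (-(2 * Real.pi * a)) * s)) * (1 / 4) : ℝ) : ℂ) * Complex.I) := by
  rw [Complex.ofReal_exp, ← Complex.exp_add, ← Complex.exp_add, ← Complex.exp_add]
  congr 1
  push_cast
  ring

end expidNeg

/-- At `y = ±½` the crest and trough `A`-terms of the line `y₀ = −¼` agree when `ξ − β ∈ ℤ`. [folklore] -/
theorem expidN_12_A (a β : ℝ) (n : ℤ) {ξ : ℝ} (hξ : ξ = β + n) (s : ℝ) :
    Complex.exp ((((-(Real.pi * a)) * s : ℝ)) * Complex.I) * (starRingEnd ℂ (Complex.exp (2 * Real.pi * β * Complex.I))) * Complex.exp (-(((2 * Real.pi * a) : ℝ) : ℂ) * (3 / 4 : ℝ)) *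
        Complex.exp ((((((2 * Real.pi * a) : ℝ)) : ℂ) + ((((2 * Real.pi * ξ) + (2 * Real.pi * a) * s : ℝ)) : ℂ) * Complex.I) * ((((1 / 2 : ℝ)) : ℝ) : ℂ)) =
      Complex.exp ((((Real.pi * a) * s : ℝ)) * Complex.I) * Complex.exp (-(((2 * Real.pi * a) : ℝ) : ℂ) * (-(1 / 4 : ℝ))) * Complex.exp ((((((2 * Real.pi * a) : ℝ)) : ℂ) + ((((2 * Real.pi * ξ) + (2 * Real.pi * a) * s : ℝ)) : ℂ) * Complex.I) * (((-(1 / 2 : ℝ)) : ℝ) : ℂ)) := by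
  rw [conj_blochZ, hξ]
  simp only [← Complex.exp_add]
  rw [Complex.exp_eq_exp_iff_exists_int]
  refine ⟨n, ?_⟩
  push_cast
  ring

/-- At `y = ±½` the crest and trough `B`-terms of the line `y₀ = −¼` agree when `ξ − β ∈ ℤ`. [folklore] -/
theorem expidN_12_B (a β : ℝ) (n : ℤ) {ξ : ℝ} (hξ : ξ = β + n) (s : ℝ) :
    Complex.exp ((((-(Real.pi * a)) * s : ℝ)) * Complex.I) * (starRingEnd ℂ (Complex.exp (2 * Real.pi * β * Complex.I))) * Complex.exp ((((2 * Real.pi * a) : ℝ) : ℂ) * (3 / 4 : ℝ)) *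
        Complex.exp ((((((-(2 * Real.pi * a)) : ℝ)) : ℂ) + ((((2 * Real.pi * ξ) + (2 * Real.pi * a) * s : ℝ)) : ℂ) * Complex.I) * ((((1 / 2 : ℝ)) : ℝ) : ℂ)) =
      Complex.exp ((((Real.pi * a) * s : ℝ)) * Complex.I) * Complex.exp ((((2 * Real.pi * a) : ℝ) : ℂ) * (-(1 / 4 : ℝ))) * Complex.exp ((((((-(2 * Real.pi * a)) : ℝ)) : ℂ) + ((((2 * Real.pi * ξ) + (2 * Real.pi * a) * s : ℝ)) : ℂ) * Complex.I) * (((-(1 / 2 : ℝ)) : ℝ) : ℂ)) := by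
  rw [conj_blochZ, hξ]
  simp only [← Complex.exp_add]
  rw [Complex.exp_eq_exp_iff_exists_int]
  refine ⟨n, ?_⟩
  push_cast
  ring

/-! ## §2 The paired bound at the partner line `y₀ = −¼` -/

section pairedNeg

variable {a : ℝ} {K G : ℝ → ℂ}

/-- **Source at `y₀ = −¼`, lattice mode `ξ = β + n`, PAIRED pointwise bound** (mirror weights: the kernel's own line is now `y = −¼`):
`‖∫_{−½}^{½} G(−¼−y) e^{2πiξy} e^{−2πiasT(y)} dy‖ ≤ (1/(1+(u+s)²) + q/(1+(u−s)²) + (1+q+2x²)|s|/(√(1+(u+s)²)√(1+(u−s)²)))/((1−q)κ²)`.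
[cite: Drazin2002, §8.3 (8.36)–(8.38)] -/
theorem norm_src_negQuarter_lattice_le (ha : 0 < a) (β : ℝ) (n : ℤ) {ξ : ℝ} (hξ : ξ = β + n) (s : ℝ)
    (hK : K = fun r : ℝ => (-((Real.exp (-(2 * Real.pi * a * r)) : ℂ) /
            (1 - starRingEnd ℂ (Complex.exp (2 * Real.pi * β * Complex.I)) * (Real.exp (-(2 * Real.pi * a)) : ℂ))
          + (Real.exp (2 * Real.pi * a * (r - 1)) : ℂ) * Complex.exp (2 * Real.pi * β * Complex.I) /
            (1 - Complex.exp (2 * Real.pi * β * Complex.I) * (Real.exp (-(2 * Real.pi * a)) : ℂ))) /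
        (2 * (2 * Real.pi * a) : ℂ)))
    (hG : ∀ u : ℝ, G u = Complex.exp (2 * Real.pi * β * (⌊u⌋ : ℝ) * Complex.I) * K (u - ⌊u⌋)) :
    ‖∫ y in (-(1 / 2 : ℝ))..(1 / 2 : ℝ), G ((-(1 / 4 : ℝ)) - y) * Complex.exp (((2 * Real.pi * ξ * y : ℝ) : ℂ) * Complex.I) *
        Complex.exp (-((2 * Real.pi * a * s * triWave y : ℝ) : ℂ) * Complex.I)‖ ≤
      (1 / (1 + (ξ / a + 1 * s) ^ 2) + Real.exp (-(2 * Real.pi * a)) / (1 + (ξ / a + (-1) * s) ^ 2) +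
          (1 + Real.exp (-(2 * Real.pi * a)) + 2 * Real.exp (-(2 * Real.pi * a) / 4) ^ 2) * |s| /
            (Real.sqrt (1 + (ξ / a + 1 * s) ^ 2) * Real.sqrt (1 + (ξ / a + (-1) * s) ^ 2))) /
        ((1 - Real.exp (-(2 * Real.pi * a))) * (2 * Real.pi * a) ^ 2) := by
  rw [src_negQuarter_pieces ha β ξ hK hG s]
  have hκ0 : 0 < 2 * Real.pi * a := by positivity
  have hκne : (2 * Real.pi * a : ℝ) ≠ 0 := hκ0.ne'
  have hκne' : (-(2 * Real.pi * a) : ℝ) ≠ 0 := by linarith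
  have nL1 := norm_lorentz_denom_mode ha (μ := 2 * Real.pi * a) (Or.inl rfl) (σ := 1) (ν := 2 * Real.pi * a) (by ring)
    (ν₀ := 2 * Real.pi * ξ) rfl s
  have nL2 := norm_lorentz_denom_mode ha (μ := -(2 * Real.pi * a)) (Or.inr rfl) (σ := 1) (ν := 2 * Real.pi * a) (by ring)
    (ν₀ := 2 * Real.pi * ξ) rfl s
  have nL3 := norm_lorentz_denom_mode ha (μ := 2 * Real.pi * a) (Or.inl rfl) (σ := -1) (ν := -(2 * Real.pi * a)) (by ring)
    (ν₀ := 2 * Real.pi * ξ) rfl s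
  have nL4 := norm_lorentz_denom_mode ha (μ := -(2 * Real.pi * a)) (Or.inr rfl) (σ := -1) (ν := -(2 * Real.pi * a)) (by ring)
    (ν₀ := 2 * Real.pi * ξ) rfl s
  have zL1 := lorentz_denom_ne_zero hκne ((2 * Real.pi * ξ) + (2 * Real.pi * a) * s)
  have zL2 := lorentz_denom_ne_zero hκne' ((2 * Real.pi * ξ) + (2 * Real.pi * a) * s)
  have zL3 := lorentz_denom_ne_zero hκne ((2 * Real.pi * ξ) + (-(2 * Real.pi * a)) * s)
  have zL4 := lorentz_denom_ne_zero hκne' ((2 * Real.pi * ξ) + (-(2 * Real.pi * a)) * s)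
  have d43 : ‖(((((-(2 * Real.pi * a)) : ℝ)) : ℂ) + ((((2 * Real.pi * ξ) + (-(2 * Real.pi * a)) * s : ℝ)) : ℂ) * Complex.I) - (((((2 * Real.pi * a) : ℝ)) : ℂ) + ((((2 * Real.pi * ξ) + (-(2 * Real.pi * a)) * s : ℝ)) : ℂ) * Complex.I)‖ = 2 * (2 * Real.pi * a) := by
    rw [show (((((-(2 * Real.pi * a)) : ℝ)) : ℂ) + ((((2 * Real.pi * ξ) + (-(2 * Real.pi * a)) * s : ℝ)) : ℂ) * Complex.I) - (((((2 * Real.pi * a) : ℝ)) : ℂ) + ((((2 * Real.pi * ξ) + (-(2 * Real.pi * a)) * s : ℝ)) : ℂ) * Complex.I) = (((-(2 * (2 * Real.pi * a))) : ℝ) : ℂ) by push_cast; ring,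
      Complex.norm_real, Real.norm_eq_abs, abs_of_neg (by linarith)]; ring
  have d21 : ‖(((((-(2 * Real.pi * a)) : ℝ)) : ℂ) + ((((2 * Real.pi * ξ) + (2 * Real.pi * a) * s : ℝ)) : ℂ) * Complex.I) - (((((2 * Real.pi * a) : ℝ)) : ℂ) + ((((2 * Real.pi * ξ) + (2 * Real.pi * a) * s : ℝ)) : ℂ) * Complex.I)‖ = 2 * (2 * Real.pi * a) := by
    rw [show (((((-(2 * Real.pi * a)) : ℝ)) : ℂ) + ((((2 * Real.pi * ξ) + (2 * Real.pi * a) * s : ℝ)) : ℂ) * Complex.I) - (((((2 * Real.pi * a) : ℝ)) : ℂ) + ((((2 * Real.pi * ξ) + (2 * Real.pi * a) * s : ℝ)) : ℂ) * Complex.I) = (((-(2 * (2 * Real.pi * a))) : ℝ) : ℂ) by push_cast; ring,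
      Complex.norm_real, Real.norm_eq_abs, abs_of_neg (by linarith)]; ring
  have d42 : ‖(((((-(2 * Real.pi * a)) : ℝ)) : ℂ) + ((((2 * Real.pi * ξ) + (-(2 * Real.pi * a)) * s : ℝ)) : ℂ) * Complex.I) - (((((-(2 * Real.pi * a)) : ℝ)) : ℂ) + ((((2 * Real.pi * ξ) + (2 * Real.pi * a) * s : ℝ)) : ℂ) * Complex.I)‖ = 2 * (2 * Real.pi * a) * |s| := by
    rw [show (((((-(2 * Real.pi * a)) : ℝ)) : ℂ) + ((((2 * Real.pi * ξ) + (-(2 * Real.pi * a)) * s : ℝ)) : ℂ) * Complex.I) - (((((-(2 * Real.pi * a)) : ℝ)) : ℂ) + ((((2 * Real.pi * ξ) + (2 * Real.pi * a) * s : ℝ)) : ℂ) * Complex.I) = (((-(2 * (2 * Real.pi * a)) * s) : ℝ) : ℂ) * Complex.I by push_cast; ring,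
      norm_mul, Complex.norm_I, mul_one, Complex.norm_real, Real.norm_eq_abs, abs_mul, abs_of_neg (by linarith)]; ring
  have d13 : ‖(((((2 * Real.pi * a) : ℝ)) : ℂ) + ((((2 * Real.pi * ξ) + (2 * Real.pi * a) * s : ℝ)) : ℂ) * Complex.I) - (((((2 * Real.pi * a) : ℝ)) : ℂ) + ((((2 * Real.pi * ξ) + (-(2 * Real.pi * a)) * s : ℝ)) : ℂ) * Complex.I)‖ = 2 * (2 * Real.pi * a) * |s| := by
    rw [show (((((2 * Real.pi * a) : ℝ)) : ℂ) + ((((2 * Real.pi * ξ) + (2 * Real.pi * a) * s : ℝ)) : ℂ) * Complex.I) - (((((2 * Real.pi * a) : ℝ)) : ℂ) + ((((2 * Real.pi * ξ) + (-(2 * Real.pi * a)) * s : ℝ)) : ℂ) * Complex.I) = (((2 * (2 * Real.pi * a)) * s : ℝ) : ℂ) * Complex.I by push_cast; ring,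
      norm_mul, Complex.norm_I, mul_one, Complex.norm_real, Real.norm_eq_abs, abs_mul, abs_of_pos (by positivity)]
  have d24 : ‖(((((-(2 * Real.pi * a)) : ℝ)) : ℂ) + ((((2 * Real.pi * ξ) + (2 * Real.pi * a) * s : ℝ)) : ℂ) * Complex.I) - (((((-(2 * Real.pi * a)) : ℝ)) : ℂ) + ((((2 * Real.pi * ξ) + (-(2 * Real.pi * a)) * s : ℝ)) : ℂ) * Complex.I)‖ = 2 * (2 * Real.pi * a) * |s| := by
    rw [show (((((-(2 * Real.pi * a)) : ℝ)) : ℂ) + ((((2 * Real.pi * ξ) + (2 * Real.pi * a) * s : ℝ)) : ℂ) * Complex.I) - (((((-(2 * Real.pi * a)) : ℝ)) : ℂ) + ((((2 * Real.pi * ξ) + (-(2 * Real.pi * a)) * s : ℝ)) : ℂ) * Complex.I) = (((2 * (2 * Real.pi * a)) * s : ℝ) : ℂ) * Complex.I by push_cast; ring,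
      norm_mul, Complex.norm_I, mul_one, Complex.norm_real, Real.norm_eq_abs, abs_mul, abs_of_pos (by positivity)]
  have ne3p4 : ‖Complex.exp ((((((2 * Real.pi * a) : ℝ)) : ℂ) + ((((2 * Real.pi * ξ) + (-(2 * Real.pi * a)) * s : ℝ)) : ℂ) * Complex.I) * ((((1 / 4 : ℝ)) : ℝ) : ℂ))‖ = Real.exp ((2 * Real.pi * a) * (1 / 4)) := norm_cexp_lorentz_mul _ _ _
  have ne4p4 : ‖Complex.exp ((((((-(2 * Real.pi * a)) : ℝ)) : ℂ) + ((((2 * Real.pi * ξ) + (-(2 * Real.pi * a)) * s : ℝ)) : ℂ) * Complex.I) * ((((1 / 4 : ℝ)) : ℝ) : ℂ))‖ = Real.exp ((-(2 * Real.pi * a)) * (1 / 4)) := norm_cexp_lorentz_mul _ _ _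
  have ne3m4 : ‖Complex.exp ((((((2 * Real.pi * a) : ℝ)) : ℂ) + ((((2 * Real.pi * ξ) + (-(2 * Real.pi * a)) * s : ℝ)) : ℂ) * Complex.I) * (((-(1 / 4 : ℝ)) : ℝ) : ℂ))‖ = Real.exp ((2 * Real.pi * a) * (-(1 / 4))) := norm_cexp_lorentz_mul _ _ _
  have ne1m4 : ‖Complex.exp ((((((2 * Real.pi * a) : ℝ)) : ℂ) + ((((2 * Real.pi * ξ) + (2 * Real.pi * a) * s : ℝ)) : ℂ) * Complex.I) * (((-(1 / 4 : ℝ)) : ℝ) : ℂ))‖ = Real.exp ((2 * Real.pi * a) * (-(1 / 4))) := norm_cexp_lorentz_mul _ _ _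
  have ne2m4 : ‖Complex.exp ((((((-(2 * Real.pi * a)) : ℝ)) : ℂ) + ((((2 * Real.pi * ξ) + (2 * Real.pi * a) * s : ℝ)) : ℂ) * Complex.I) * (((-(1 / 4 : ℝ)) : ℝ) : ℂ))‖ = Real.exp ((-(2 * Real.pi * a)) * (-(1 / 4))) := norm_cexp_lorentz_mul _ _ _
  have nP1 : ‖Complex.exp ((((Real.pi * a) * s : ℝ)) * Complex.I)‖ = 1 := Complex.norm_exp_ofReal_mul_I _
  have nP2 : ‖Complex.exp ((((0 : ℝ) * s : ℝ)) * Complex.I)‖ = 1 := Complex.norm_exp_ofReal_mul_I _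
  have hP2 : Complex.exp ((((0 : ℝ) * s : ℝ)) * Complex.I) = 1 := by simp
  have nzc : ‖(starRingEnd ℂ (Complex.exp (2 * Real.pi * β * Complex.I)))‖ = 1 := norm_pref_conj β
  have nFm1 : ‖Complex.exp (-(((2 * Real.pi * a) : ℝ) : ℂ) * (-(1 / 4 : ℝ)))‖ = Real.exp (-(2 * Real.pi * a) * (-(1 / 4))) := by
    rw [show -(((2 * Real.pi * a) : ℝ) : ℂ) * -(((1 / 4 : ℝ)) : ℂ) = (((-(2 * Real.pi * a) * (-(1 / 4))) : ℝ) : ℂ) by push_cast; ring,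
      Complex.norm_exp_ofReal]
  have nFp1 : ‖Complex.exp ((((2 * Real.pi * a) : ℝ) : ℂ) * (-(1 / 4 : ℝ)))‖ = Real.exp ((2 * Real.pi * a) * (-(1 / 4))) := by
    rw [show (((2 * Real.pi * a) : ℝ) : ℂ) * -(((1 / 4 : ℝ)) : ℂ) = ((((2 * Real.pi * a) * (-(1 / 4))) : ℝ) : ℂ) by push_cast; ring,
      Complex.norm_exp_ofReal]
  have nFm3 : ‖Complex.exp (-(((2 * Real.pi * a) : ℝ) : ℂ) * (3 / 4 : ℝ))‖ = Real.exp (-(2 * Real.pi * a) * (3 / 4)) := by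
    rw [show -(((2 * Real.pi * a) : ℝ) : ℂ) * (3 / 4 : ℝ) = (((-(2 * Real.pi * a) * (3 / 4)) : ℝ) : ℂ) by push_cast; ring, Complex.norm_exp_ofReal]
  have nFp3 : ‖Complex.exp ((((2 * Real.pi * a) : ℝ) : ℂ) * (3 / 4 : ℝ))‖ = Real.exp ((2 * Real.pi * a) * (3 / 4)) := by
    rw [show (((2 * Real.pi * a) : ℝ) : ℂ) * (3 / 4 : ℝ) = ((((2 * Real.pi * a) * (3 / 4)) : ℝ) : ℂ) by push_cast; ring, Complex.norm_exp_ofReal]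
  have nA := norm_coefA_le ha β
  have nB := norm_coefB_le ha β
  have J1 := expidN_14_A a ξ s
  have J2 := expidN_14_B a ξ s
  have J3 := expidN_12_A a β n hξ s
  have J4 := expidN_12_B a β n hξ s
  have V1 := expidN_m14_W1 a ξ s
  have V2 := expidN_m14_W2 a ξ s
  have V3 := expidN_m14_W3 a ξ s
  have V4 := expidN_m14_W4 a ξ s
  have KC := kernel_coef_continuity ha β
  set A : ℂ := (-1 / ((1 - starRingEnd ℂ (Complex.exp (2 * Real.pi * β * Complex.I)) * (Real.exp (-(2 * Real.pi * a)) : ℂ)) * (2 * (2 * Real.pi * a))) : ℂ) with hA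
  set B : ℂ := (-(Complex.exp (2 * Real.pi * β * Complex.I) * (Real.exp (-(2 * Real.pi * a)) : ℂ)) / ((1 - Complex.exp (2 * Real.pi * β * Complex.I) * (Real.exp (-(2 * Real.pi * a)) : ℂ)) * (2 * (2 * Real.pi * a))) : ℂ) with hB
  set zc : ℂ := (starRingEnd ℂ (Complex.exp (2 * Real.pi * β * Complex.I))) with hzc
  set Fm1 : ℂ := Complex.exp (-(((2 * Real.pi * a) : ℝ) : ℂ) * (-(1 / 4 : ℝ))) with hFm1
  set Fp1 : ℂ := Complex.exp ((((2 * Real.pi * a) : ℝ) : ℂ) * (-(1 / 4 : ℝ))) with hFp1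
  set Fm3 : ℂ := Complex.exp (-(((2 * Real.pi * a) : ℝ) : ℂ) * (3 / 4 : ℝ)) with hFm3
  set Fp3 : ℂ := Complex.exp ((((2 * Real.pi * a) : ℝ) : ℂ) * (3 / 4 : ℝ)) with hFp3
  set P₁ : ℂ := Complex.exp ((((Real.pi * a) * s : ℝ)) * Complex.I) with hP₁
  set P₂ : ℂ := Complex.exp ((((0 : ℝ) * s : ℝ)) * Complex.I) with hP₂
  set P₃ : ℂ := Complex.exp ((((-(Real.pi * a)) * s : ℝ)) * Complex.I) with hP₃
  set Wq : ℂ := Complex.exp ((((-((2 * Real.pi * ξ) + (-(2 * Real.pi * a)) * s)) * (1 / 4) : ℝ) : ℂ) * Complex.I) with hWq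
  set L₁ : ℂ := (((((2 * Real.pi * a) : ℝ)) : ℂ) + ((((2 * Real.pi * ξ) + (2 * Real.pi * a) * s : ℝ)) : ℂ) * Complex.I) with hL₁
  set L₂ : ℂ := (((((-(2 * Real.pi * a)) : ℝ)) : ℂ) + ((((2 * Real.pi * ξ) + (2 * Real.pi * a) * s : ℝ)) : ℂ) * Complex.I) with hL₂
  set L₃ : ℂ := (((((2 * Real.pi * a) : ℝ)) : ℂ) + ((((2 * Real.pi * ξ) + (-(2 * Real.pi * a)) * s : ℝ)) : ℂ) * Complex.I) with hL₃
  set L₄ : ℂ := (((((-(2 * Real.pi * a)) : ℝ)) : ℂ) + ((((2 * Real.pi * ξ) + (-(2 * Real.pi * a)) * s : ℝ)) : ℂ) * Complex.I) with hL₄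
  set e1m4 : ℂ := Complex.exp (L₁ * (((-(1 / 4 : ℝ)) : ℝ) : ℂ)) with he1m4
  set e1m2 : ℂ := Complex.exp (L₁ * (((-(1 / 2 : ℝ)) : ℝ) : ℂ)) with he1m2
  set e2m4 : ℂ := Complex.exp (L₂ * (((-(1 / 4 : ℝ)) : ℝ) : ℂ)) with he2m4
  set e2m2 : ℂ := Complex.exp (L₂ * (((-(1 / 2 : ℝ)) : ℝ) : ℂ)) with he2m2
  set e3p4 : ℂ := Complex.exp (L₃ * ((((1 / 4 : ℝ)) : ℝ) : ℂ)) with he3p4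
  set e3m4 : ℂ := Complex.exp (L₃ * (((-(1 / 4 : ℝ)) : ℝ) : ℂ)) with he3m4
  set e4p4 : ℂ := Complex.exp (L₄ * ((((1 / 4 : ℝ)) : ℝ) : ℂ)) with he4p4
  set e4m4 : ℂ := Complex.exp (L₄ * (((-(1 / 4 : ℝ)) : ℝ) : ℂ)) with he4m4
  set e1p2 : ℂ := Complex.exp (L₁ * ((((1 / 2 : ℝ)) : ℝ) : ℂ)) with he1p2
  set e1p4 : ℂ := Complex.exp (L₁ * ((((1 / 4 : ℝ)) : ℝ) : ℂ)) with he1p4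
  set e2p2 : ℂ := Complex.exp (L₂ * ((((1 / 2 : ℝ)) : ℝ) : ℂ)) with he2p2
  set e2p4 : ℂ := Complex.exp (L₂ * ((((1 / 4 : ℝ)) : ℝ) : ℂ)) with he2p4
  rw [six_pieces_regroup]
  have hV : P₁ * (1 * A * Fm1) * e1m4 + P₁ * (1 * B * Fp1) * e2m4 = P₂ * (zc * A * Fm3) * e3m4 + P₂ * (zc * B * Fp3) * e4m4 := by
    linear_combination A * V1 + B * V2 - zc * A * V3 - zc * B * V4 + Wq * KC
  have hρ₁ : P₃ * (zc * A * Fm3) * e1p4 = P₂ * (zc * A * Fm3) * e3p4 := by linear_combination (-(zc * A * Fm3)) * J1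
  have hρ₂ : P₃ * (zc * B * Fp3) * e2p4 = P₂ * (zc * B * Fp3) * e4p4 := by linear_combination (-(zc * B * Fp3)) * J2
  have hσ₁ : P₃ * (zc * A * Fm3) * e1p2 = P₁ * (1 * A * Fm1) * e1m2 := by linear_combination A * J3
  have hσ₂ : P₃ * (zc * B * Fp3) * e2p2 = P₁ * (1 * B * Fp1) * e2m2 := by linear_combination B * J4
  rw [hρ₁, hρ₂, hσ₁, hσ₂, sub_self, sub_self, add_zero, add_zero]
  rw [show P₂ * (zc * A * Fm3) * e3p4 / L₃ + P₂ * (zc * B * Fp3) * e4p4 / L₄ - P₂ * (zc * A * Fm3) * e3p4 / L₁ -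
      P₂ * (zc * B * Fp3) * e4p4 / L₂ = (P₂ * (zc * A * Fm3) * e3p4 / L₃ - P₂ * (zc * A * Fm3) * e3p4 / L₁) +
      (P₂ * (zc * B * Fp3) * e4p4 / L₄ - P₂ * (zc * B * Fp3) * e4p4 / L₂) by ring,
    show P₁ * (1 * A * Fm1) * e1m4 / L₁ - P₂ * (zc * A * Fm3) * e3m4 / L₃ + (P₁ * (1 * B * Fp1) * e2m4 / L₂ - P₂ * (zc * B * Fp3) * e4m4 / L₄) =
      P₁ * (1 * A * Fm1) * e1m4 / L₁ + P₁ * (1 * B * Fp1) * e2m4 / L₂ - P₂ * (zc * A * Fm3) * e3m4 / L₃ - P₂ * (zc * B * Fp3) * e4m4 / L₄ by ring]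
  -- powers of `x = e^{-κ/4}`
  set X : ℝ := Real.exp (-(2 * Real.pi * a) / 4) with hX
  have hX0 : 0 < X := Real.exp_pos _
  have hq : Real.exp (-(2 * Real.pi * a)) = X ^ 4 := by rw [hX, ← Real.exp_nat_mul]; congr 1; push_cast; ring
  have hxa : Real.exp (-(2 * Real.pi * a) * -(1 / 4)) = X⁻¹ := by rw [hX, ← Real.exp_neg]; congr 1; ring
  have hxb : Real.exp (2 * Real.pi * a * -(1 / 4)) = X := by rw [hX]; congr 1; ring
  have hx3 : Real.exp (-(2 * Real.pi * a) * (3 / 4)) = X ^ 3 := by rw [hX, ← Real.exp_nat_mul]; congr 1; push_cast; ring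
  have hxi3 : Real.exp (2 * Real.pi * a * (3 / 4)) = (X⁻¹) ^ 3 := by
    rw [hX, ← Real.exp_neg, ← Real.exp_nat_mul]; congr 1; push_cast; ring
  have hxi : Real.exp (2 * Real.pi * a * (1 / 4)) = X⁻¹ := by rw [hX, ← Real.exp_neg]; congr 1; ring
  have hx1 : Real.exp (-(2 * Real.pi * a) * (1 / 4)) = X := by rw [hX]; congr 1; ring
  have hX1 : X ^ 4 < 1 := by rw [← hq]; exact Real.exp_lt_one_iff.2 (by linarith)
  -- norms of the boundary values
  have nLp : ‖P₁ * (1 * A * Fm1) * e1m4‖ = ‖A‖ := by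
    rw [norm_mul, norm_mul, norm_mul, norm_mul, norm_one, nP1, nFm1, ne1m4, hxa, hxb]; field_simp
  have nLm : ‖P₁ * (1 * B * Fp1) * e2m4‖ = ‖B‖ := by
    rw [norm_mul, norm_mul, norm_mul, norm_mul, norm_one, nP1, nFp1, ne2m4, hxa, hxb]; field_simp
  have nRp : ‖P₂ * (zc * A * Fm3) * e3m4‖ = ‖A‖ * X ^ 4 := by
    rw [norm_mul, norm_mul, norm_mul, norm_mul, nP2, nzc, nFm3, ne3m4, hx3, hxb]; ring
  have nρ₁ : ‖P₂ * (zc * A * Fm3) * e3p4‖ = ‖A‖ * X ^ 2 := by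
    rw [norm_mul, norm_mul, norm_mul, norm_mul, nP2, nzc, nFm3, ne3p4, hx3, hxi]; field_simp
  have nρ₂ : ‖P₂ * (zc * B * Fp3) * e4p4‖ = ‖B‖ * (X⁻¹) ^ 2 := by
    rw [norm_mul, norm_mul, norm_mul, norm_mul, nP2, nzc, nFp3, ne4p4, hxi3, hx1]; field_simp
  have nV : ‖P₁ * (1 * A * Fm1) * e1m4 + P₁ * (1 * B * Fp1) * e2m4‖ ≤ ‖A‖ + ‖B‖ := by
    refine (norm_add_le _ _).trans (le_of_eq ?_); rw [nLp, nLm]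
  set Dp : ℝ := Real.sqrt (1 + (ξ / a + 1 * s) ^ 2) with hDp
  set Dm : ℝ := Real.sqrt (1 + (ξ / a + (-1) * s) ^ 2) with hDm
  have hDp0 : 0 < Dp := Real.sqrt_pos.2 (by positivity)
  have hDm0 : 0 < Dm := Real.sqrt_pos.2 (by positivity)
  have hDp2 : Dp ^ 2 = 1 + (ξ / a + 1 * s) ^ 2 := Real.sq_sqrt (by positivity)
  have hDm2 : Dm ^ 2 = 1 + (ξ / a + (-1) * s) ^ 2 := Real.sq_sqrt (by positivity)
  have hA0 : 0 ≤ ‖A‖ := norm_nonneg _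
  have hB0 : 0 ≤ ‖B‖ := norm_nonneg _
  have hGm := norm_kink_pair_le (d₃ := L₁) (d₄ := L₂) (d₁ := L₃) (d₂ := L₄) hV zL3 zL4 zL1 zL2
  rw [nLp, nRp, d21, d43, d42, nL1, nL2, nL3, nL4] at hGm
  have hGm' : ‖P₁ * (1 * A * Fm1) * e1m4 / L₁ + P₁ * (1 * B * Fp1) * e2m4 / L₂ - P₂ * (zc * A * Fm3) * e3m4 / L₃ -
      P₂ * (zc * B * Fp3) * e4m4 / L₄‖ ≤
      ‖A‖ * (2 * (2 * Real.pi * a)) / ((2 * Real.pi * a * Dp) * (2 * Real.pi * a * Dp)) +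
        ‖A‖ * X ^ 4 * (2 * (2 * Real.pi * a)) / ((2 * Real.pi * a * Dm) * (2 * Real.pi * a * Dm)) +
        (‖A‖ + ‖B‖) * (2 * (2 * Real.pi * a) * |s|) / ((2 * Real.pi * a * Dm) * (2 * Real.pi * a * Dp)) := by
    refine hGm.trans (add_le_add le_rfl ?_)
    exact div_le_div_of_nonneg_right (mul_le_mul_of_nonneg_right nV (by positivity)) (by positivity)
  have hG14 : ‖P₂ * (zc * A * Fm3) * e3p4 / L₃ - P₂ * (zc * A * Fm3) * e3p4 / L₁ +
      (P₂ * (zc * B * Fp3) * e4p4 / L₄ - P₂ * (zc * B * Fp3) * e4p4 / L₂)‖ ≤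
      ‖A‖ * X ^ 2 * (2 * (2 * Real.pi * a) * |s|) / ((2 * Real.pi * a * Dm) * (2 * Real.pi * a * Dp)) +
        ‖B‖ * (X⁻¹) ^ 2 * (2 * (2 * Real.pi * a) * |s|) / ((2 * Real.pi * a * Dm) * (2 * Real.pi * a * Dp)) := by
    refine (norm_add_le _ _).trans (le_of_eq ?_)
    rw [norm_same_pair_eq _ zL3 zL1, norm_same_pair_eq _ zL4 zL2, nρ₁, nρ₂, d13, d24, nL1, nL2, nL3, nL4]
  refine (norm_add_le _ _).trans ((add_le_add hG14 hGm').trans ?_)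
  rw [hq] at nA nB ⊢
  have h1q : 0 < 1 - X ^ 4 := by linarith
  have key : ‖A‖ * X ^ 2 * (2 * (2 * Real.pi * a) * |s|) / ((2 * Real.pi * a * Dm) * (2 * Real.pi * a * Dp)) +
        ‖B‖ * (X⁻¹) ^ 2 * (2 * (2 * Real.pi * a) * |s|) / ((2 * Real.pi * a * Dm) * (2 * Real.pi * a * Dp)) +
      (‖A‖ * (2 * (2 * Real.pi * a)) / ((2 * Real.pi * a * Dp) * (2 * Real.pi * a * Dp)) +
        ‖A‖ * X ^ 4 * (2 * (2 * Real.pi * a)) / ((2 * Real.pi * a * Dm) * (2 * Real.pi * a * Dm)) +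
        (‖A‖ + ‖B‖) * (2 * (2 * Real.pi * a) * |s|) / ((2 * Real.pi * a * Dm) * (2 * Real.pi * a * Dp))) =
      ‖A‖ * ((2 * (2 * Real.pi * a)) / ((2 * Real.pi * a * Dp) * (2 * Real.pi * a * Dp)) +
          X ^ 4 * (2 * (2 * Real.pi * a)) / ((2 * Real.pi * a * Dm) * (2 * Real.pi * a * Dm)) +
          (1 + X ^ 2) * (2 * (2 * Real.pi * a) * |s|) / ((2 * Real.pi * a * Dm) * (2 * Real.pi * a * Dp))) +
        ‖B‖ * ((1 + (X⁻¹) ^ 2) * (2 * (2 * Real.pi * a) * |s|) / ((2 * Real.pi * a * Dm) * (2 * Real.pi * a * Dp))) := by ring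
  rw [key]
  have cA : 0 ≤ (2 * (2 * Real.pi * a)) / ((2 * Real.pi * a * Dp) * (2 * Real.pi * a * Dp)) +
      X ^ 4 * (2 * (2 * Real.pi * a)) / ((2 * Real.pi * a * Dm) * (2 * Real.pi * a * Dm)) +
      (1 + X ^ 2) * (2 * (2 * Real.pi * a) * |s|) / ((2 * Real.pi * a * Dm) * (2 * Real.pi * a * Dp)) := by positivity
  have cB : 0 ≤ (1 + (X⁻¹) ^ 2) * (2 * (2 * Real.pi * a) * |s|) / ((2 * Real.pi * a * Dm) * (2 * Real.pi * a * Dp)) := by positivity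
  refine (add_le_add (mul_le_mul_of_nonneg_right nA cA) (mul_le_mul_of_nonneg_right nB cB)).trans (le_of_eq ?_)
  rw [show (1 : ℝ) / (1 + (ξ / a + 1 * s) ^ 2) = 1 / Dp ^ 2 by rw [hDp2],
    show X ^ 4 / (1 + (ξ / a + (-1) * s) ^ 2) = X ^ 4 / Dm ^ 2 by rw [hDm2]]
  field_simp
  ring

end pairedNeg

/-! ## §3 The common paired envelope of both kink lines -/

section env

variable {a : ℝ} {K G : ℝ → ℂ}

/-- `1/D₋² + q/D₊² + N|s|/(D₊D₋) ≤ N(1+|s|/2)(1/D₊² + 1/D₋²)` for `1, q ≤ N`, `|s| ≥ 0` (AM–GM on the cross term). [folklore] -/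
theorem paired_weights_le_env {q N t Dp Dm : ℝ} (hq : q ≤ N) (h1 : 1 ≤ N) (ht : 0 ≤ t) (hDp : 0 < Dp) (hDm : 0 < Dm) :
    1 / Dm ^ 2 + q / Dp ^ 2 + N * t / (Dp * Dm) ≤ N * (1 + t / 2) * (1 / Dp ^ 2 + 1 / Dm ^ 2) := by
  have hx : 0 < 1 / Dp ^ 2 := by positivity
  have hy : 0 < 1 / Dm ^ 2 := by positivity
  have hcross : 1 / (Dp * Dm) ≤ (1 / Dp ^ 2 + 1 / Dm ^ 2) / 2 := by
    have h1 : 0 ≤ (1 / Dp - 1 / Dm) ^ 2 := sq_nonneg _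
    have h2 : (1 / Dp - 1 / Dm) ^ 2 = 1 / Dp ^ 2 + 1 / Dm ^ 2 - 2 * (1 / (Dp * Dm)) := by
      field_simp
      ring
    linarith
  have e1 : 1 / Dm ^ 2 + q / Dp ^ 2 ≤ N * (1 / Dp ^ 2 + 1 / Dm ^ 2) := by
    rw [show q / Dp ^ 2 = q * (1 / Dp ^ 2) by ring]
    nlinarith [mul_le_mul_of_nonneg_right hq hx.le, mul_le_mul_of_nonneg_right h1 hy.le]
  have e2 : N * t / (Dp * Dm) ≤ N * (t / 2) * (1 / Dp ^ 2 + 1 / Dm ^ 2) := by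
    rw [show N * t / (Dp * Dm) = N * t * (1 / (Dp * Dm)) by ring, show N * (t / 2) * (1 / Dp ^ 2 + 1 / Dm ^ 2) =
      N * t * ((1 / Dp ^ 2 + 1 / Dm ^ 2) / 2) by ring]
    exact mul_le_mul_of_nonneg_left hcross (mul_nonneg (by linarith) ht)
  nlinarith

/-- **The common PAIRED ENVELOPE of the single-mode sources at both kink lines** (`a > 0`, lattice mode `ξ = β + n`, any `s`):
`‖∫ G(y₀−y) e^{2πiξy} e^{−2πiasT(y)} dy‖ ≤ (1+q+2x²)(1+|s|/2)(1/(1+(ξ/a+s)²) + 1/(1+(ξ/a−s)²))/((1−q)κ²)`, `y₀ ∈ {¼, −¼}`: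
quadratic Doppler decay (the `1/ξ²` law for far modes). [cite: Drazin2002, §8.3 (8.36)–(8.38)] -/
theorem norm_src_lattice_env_le (ha : 0 < a) (β : ℝ) (n : ℤ) {ξ : ℝ} (hξ : ξ = β + n) {y₀ : ℝ} (hy₀ : y₀ = 1 / 4 ∨ y₀ = -(1 / 4)) (s : ℝ)
    (hK : K = fun r : ℝ => (-((Real.exp (-(2 * Real.pi * a * r)) : ℂ) /
            (1 - starRingEnd ℂ (Complex.exp (2 * Real.pi * β * Complex.I)) * (Real.exp (-(2 * Real.pi * a)) : ℂ))
          + (Real.exp (2 * Real.pi * a * (r - 1)) : ℂ) * Complex.exp (2 * Real.pi * β * Complex.I) /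
            (1 - Complex.exp (2 * Real.pi * β * Complex.I) * (Real.exp (-(2 * Real.pi * a)) : ℂ))) /
        (2 * (2 * Real.pi * a) : ℂ)))
    (hG : ∀ u : ℝ, G u = Complex.exp (2 * Real.pi * β * (⌊u⌋ : ℝ) * Complex.I) * K (u - ⌊u⌋)) :
    ‖∫ y in (-(1 / 2 : ℝ))..(1 / 2 : ℝ), G (y₀ - y) * Complex.exp (((2 * Real.pi * ξ * y : ℝ) : ℂ) * Complex.I) *
        Complex.exp (-((2 * Real.pi * a * s * triWave y : ℝ) : ℂ) * Complex.I)‖ ≤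
      (1 + Real.exp (-(2 * Real.pi * a)) + 2 * Real.exp (-(2 * Real.pi * a) / 4) ^ 2) * (1 + |s| / 2) *
          (1 / (1 + (ξ / a + 1 * s) ^ 2) + 1 / (1 + (ξ / a + (-1) * s) ^ 2)) /
        ((1 - Real.exp (-(2 * Real.pi * a))) * (2 * Real.pi * a) ^ 2) := by
  have hq1 : Real.exp (-(2 * Real.pi * a)) < 1 := Real.exp_lt_one_iff.2 (by nlinarith [Real.pi_pos])
  have hN1 : 1 ≤ 1 + Real.exp (-(2 * Real.pi * a)) + 2 * Real.exp (-(2 * Real.pi * a) / 4) ^ 2 := by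
    nlinarith [sq_nonneg (Real.exp (-(2 * Real.pi * a) / 4)), Real.exp_pos (-(2 * Real.pi * a))]
  have hNq : Real.exp (-(2 * Real.pi * a)) ≤ 1 + Real.exp (-(2 * Real.pi * a)) + 2 * Real.exp (-(2 * Real.pi * a) / 4) ^ 2 := by
    nlinarith [sq_nonneg (Real.exp (-(2 * Real.pi * a) / 4))]
  have hDp : 0 < Real.sqrt (1 + (ξ / a + 1 * s) ^ 2) := Real.sqrt_pos.2 (by positivity)
  have hDm : 0 < Real.sqrt (1 + (ξ / a + (-1) * s) ^ 2) := Real.sqrt_pos.2 (by positivity)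
  have hDp2 : Real.sqrt (1 + (ξ / a + 1 * s) ^ 2) ^ 2 = 1 + (ξ / a + 1 * s) ^ 2 := Real.sq_sqrt (by positivity)
  have hDm2 : Real.sqrt (1 + (ξ / a + (-1) * s) ^ 2) ^ 2 = 1 + (ξ / a + (-1) * s) ^ 2 := Real.sq_sqrt (by positivity)
  have hden : 0 < (1 - Real.exp (-(2 * Real.pi * a))) * (2 * Real.pi * a) ^ 2 := by
    have : 0 < (2 * Real.pi * a) ^ 2 := by positivity
    nlinarith
  rcases hy₀ with h | h <;> subst h
  · refine (norm_src_quarter_lattice_le ha β n hξ s hK hG).trans (div_le_div_of_nonneg_right ?_ hden.le)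
    have h := paired_weights_le_env (t := |s|) hNq hN1 (abs_nonneg s) hDp hDm
    rw [hDp2, hDm2] at h
    linarith
  · refine (norm_src_negQuarter_lattice_le ha β n hξ s hK hG).trans (div_le_div_of_nonneg_right ?_ hden.le)
    have h := paired_weights_le_env (t := |s|) hNq hN1 (abs_nonneg s) hDm hDp
    rw [hDp2, hDm2, mul_comm (Real.sqrt (1 + (ξ / a + (-1) * s) ^ 2)) (Real.sqrt (1 + (ξ / a + 1 * s) ^ 2)),
      add_comm (1 / (1 + (ξ / a + (-1) * s) ^ 2)) (1 / (1 + (ξ / a + 1 * s) ^ 2))] at h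
    linarith

end env

end Summit.AnomalousDissipation.AnomalousDissipation.Theorems.SawtoothPulseCascade.K2PhaseBudget

end
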